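import Summits.NavierStokesRegularity.NavierStokesRegularity.Theorems.StrainClockBudgetedClosers
import Summits.NavierStokesRegularity.NavierStokesRegularity.Theorems.StrainDoors
import HarnessLib

/-!
# StrainDoorsDefectLifespan — door D12 «DefectLifespanDoor»: the SUPER-PARITY branch of the strain clock (part 1 of 2; nsreg-p1 g34, ROUND-50)

Part 1 of 2 (§1–§2); part 2 `…Theorems.StrainDoorsDefectLifespanDoor` carries §3–§4 (door text, closer, law, D5 ⊆ D12).

Door D5 `BudgetedParityDoor` (p1 ROUND-39, CLOSED `budgetedParityDoor_holds`) charges the strain feed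
`H = ¼(|ω|² − ω_e²) − ∇²p(e,e)` at the `δ`-almost strain maximisers above a level `l₀` with PARITY UP TO AN INTEGRABLE
BUDGET, `H ≤ q² + b(t)·q`, and concludes continuation.  This file treats the complementary, physically generic case of a
PARITY DEFECT: `H ≤ c·q² + b(t)·q` with a constant `c ≥ 1` (`c − 1` = the relative super-parity excess of the feed over
the restricted-Euler self-depletion `−q²`).  The growth law at a charged crossing point is then SUPER-LINEAR,
`∂ₜq ≤ (c − 1)q² + (b + η(ε))q`, which the tree's linear threshold device E2_S♭-lin
(`strainThresholdAlmostLinear_holds`) cannot take as it stands.  THE NEW MOVE is a bootstrap: the slope is frozen to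
`(c − 1)·g(s)` with `g` a CONTINUOUS A-PRIORI MAJORANT of the strain form (the supremum over a large compact set of
positions × unit directions, continuous by `IsCompact.continuous_sSup`, glued with the uniform spatial decay
`gradientUniformDecay_holds`), the device is run with the barrier `B = Λ₀·e^{Φ}·exp((c−1)∫g)`, and the resulting
integral inequality `g ≤ Λ₀e^{β}·exp((c−1)∫g)` is closed by an exact Bihari/Riccati comparison (§1).  Results:

* §1 `exp_mul_integral_le_of_bootstrap` — the real-variable Riccati-from-Grönwall lemma (exact constant).
* §2 `strain_le_of_defect` — **THE DEFECT RICCATI BOUND** (PROVED, Sobolev frame of D5): if `⟪∇u(t₀)e,e⟫ ≤ Λ₀`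
  (`0 < Λ₀`, `l₀ ≤ Λ₀`) and the budgeted `c`-parity holds at the charged almost-maximisers on `[t₀,T)`, then for every
  `t ∈ [t₀,T)` with `(c−1)Λ₀e^{β}(t − t₀) < 1`:  `⟪∇u(t,x)e,e⟫ ≤ Λ₀e^{β} / (1 − (c−1)Λ₀e^{β}(t − t₀))`.
* §3 `DefectLifespanDoor` (door D12, text) and `defectLifespanDoor_holds` (CLOSED): if moreover
  `(c−1)Λ₀e^{β}(T − t₀) < 1`, the solution continues past `T`.  Equivalently (`defect_lifespan_law`): a blow-up at `T`
  forces `(c − 1)·Λ₀·e^{β}·(T − t₀) ≥ 1` on EVERY window `[t₀,T)` — the LIFESPAN from `t₀` is at least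
  `1/((c−1)e^{β}Λ(t₀))`, i.e. the parity defect `c − 1` is bounded below by the inverse strain-Type-I number
  `e^{−β}/(Λ(t₀)(T − t₀))`.
* §4 `budgetedParityDoor_of_defectLifespanDoor : DefectLifespanDoor → BudgetedParityDoor` — D5 is the case `c = 1`
  (the a-priori `Λ₀` always exists in the Sobolev frame), so D12 ⊋ D5 as a door text; and the restricted-Euler reading
  `defectLifespan_restrictedEuler` (`b ≡ 0`, `β = 0`: lifespan `≥ 1/((c−1)Λ₀)`, the Vieillefosse clock slowed by the
  factor `1/(c−1)`).

Dependencies: E1_S♭ `strainGrowthWeighted`, F_S `strainFrame_holds`, E2_S♭-lin `strainThresholdAlmostLinear_holds`,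
D_S `gradientUniformDecay_holds`, door Λ `subcriticalStrainDoor_holds`, the Sobolev sup bounds
`exists_forall_norm_le_of_hasBoundedSobolevNormsOn` / `exists_forall_norm_iteratedFDeriv_le_of_hasBoundedSobolevNormsOn`
— all in the tree, so everything here is UNCONDITIONAL (std axioms).

HONEST LABEL: a conditional continuation criterion and its quantitative form (variant of D5/D6 in the door census of
ROUND-49 §(4); the NEW content is the super-linear branch `c > 1`, which the fixed-scale census lacked, and its reading
as a LIFESPAN / Type-I law).  WHAT THIS IS NOT: items 0056 `NoTypeII`, 10661 and NS regularity are NOT proved; the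
Type-I number here is the STRAIN number `Λ(t)(T−t)`, not Leray's `‖u‖_∞√(T−t)`; no Literature fact is a hypothesis;
nothing here is a route or a summit statement (`--supports stmt-NavierStokesRegularity-0056 --as helper`).
-/

noncomputable section

open MeasureTheory Set Function Filter Metric Real InnerProductSpace
open _root_.Topology
open scoped ENNReal NNReal RealInnerProductSpace ContDiff Laplacian Interval
open Literature.Analysis Literature.Analysis.FluidPDE
open Literature.Analysis.FluidPDE.VorticityDirectionDynamics

set_option linter.dupNamespace false
set_option linter.unusedSectionVars false

namespace Summit.NavierStokesRegularity.NavierStokesRegularity.Theorems.StrainDoors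

open Summit.NavierStokesRegularity.NavierStokesRegularity.Theorems.ArgmaxDoors

-- nested operator types (second derivatives)
set_option maxSynthPendingDepth 3

/-! ## §1 The Riccati-from-Grönwall (Bihari) lemma -/

/-- **Bihari / Riccati comparison, exponential form.** If `g` is continuous and `g(s) ≤ A·exp(κ∫_{t₀}^{s} g)` on
`[t₀,t₂]` (`A > 0`, `κ ≥ 0`, `κA(t₂ − t₀) < 1`), then `exp(κ∫_{t₀}^{s} g) ≤ (1 − κA(s − t₀))⁻¹` on `[t₀,t₂]`.
Proof: `F = exp(−κ∫g) + κA(s − t₀)` has `F' = κ(A − g·exp(−κ∫g)) ≥ 0`, `F(t₀) = 1`. [folklore] -/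
theorem exp_mul_integral_le_of_bootstrap {g : ℝ → ℝ} {t₀ t₂ A κ : ℝ} (hg : Continuous g) (hA : 0 < A)
    (hκ : 0 ≤ κ) (hsmall : κ * A * (t₂ - t₀) < 1)
    (hboot : ∀ s ∈ Icc t₀ t₂, g s ≤ A * Real.exp (κ * ∫ r in t₀..s, g r)) :
    ∀ s ∈ Icc t₀ t₂, Real.exp (κ * ∫ r in t₀..s, g r) ≤ (1 - κ * A * (s - t₀))⁻¹ := by
  intro s hs
  set G : ℝ → ℝ := fun s => ∫ r in t₀..s, g r with hG
  have hGd : ∀ s, HasDerivAt G (g s) s := fun s => (hg.integral_hasStrictDerivAt t₀ s).hasDerivAt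
  set F : ℝ → ℝ := fun s => Real.exp (-(κ * G s)) + κ * A * (s - t₀) with hF
  have hFd : ∀ s, HasDerivAt F (Real.exp (-(κ * G s)) * (-(κ * g s)) + κ * A * 1) s := fun s =>
    (((hGd s).const_mul κ).neg.exp).add (((hasDerivAt_id s).sub_const t₀).const_mul (κ * A))
  have hF0 : F t₀ = 1 := by simp [hF, hG, intervalIntegral.integral_same]
  -- `F' ≥ 0` on `[t₀,t₂]`
  have hF'nn : ∀ s ∈ Icc t₀ t₂, 0 ≤ Real.exp (-(κ * G s)) * (-(κ * g s)) + κ * A * 1 := by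
    intro s hs
    have hb := hboot s hs
    have hexp : 0 < Real.exp (κ * G s) := Real.exp_pos _
    have hinv : Real.exp (-(κ * G s)) = (Real.exp (κ * G s))⁻¹ := Real.exp_neg _
    have h1 : g s * Real.exp (-(κ * G s)) ≤ A := by
      rw [hinv, ← div_eq_mul_inv, div_le_iff₀ hexp]
      simpa [hG] using hb
    have h2 : κ * (g s * Real.exp (-(κ * G s))) ≤ κ * A := mul_le_mul_of_nonneg_left h1 hκ
    nlinarith [h2]
  have hmono : MonotoneOn F (Icc t₀ t₂) := by
    refine monotoneOn_of_hasDerivWithinAt_nonneg (convex_Icc t₀ t₂)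
      (fun s _ => (hFd s).continuousAt.continuousWithinAt) (f' := fun s =>
        Real.exp (-(κ * G s)) * (-(κ * g s)) + κ * A * 1) ?_ ?_
    · intro s _; exact (hFd s).hasDerivWithinAt
    · intro s hs'
      rw [interior_Icc] at hs'
      exact hF'nn s ⟨hs'.1.le, hs'.2.le⟩
  have hFs : 1 ≤ F s := by
    rw [← hF0]
    exact hmono ⟨le_rfl, hs.1.trans hs.2⟩ hs hs.1
  have hpos : 0 < 1 - κ * A * (s - t₀) := by
    have : κ * A * (s - t₀) ≤ κ * A * (t₂ - t₀) :=
      mul_le_mul_of_nonneg_left (by linarith [hs.2]) (mul_nonneg hκ hA.le)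
    linarith
  have hle : 1 - κ * A * (s - t₀) ≤ Real.exp (-(κ * G s)) := by
    have : F s = Real.exp (-(κ * G s)) + κ * A * (s - t₀) := rfl
    linarith
  have h := inv_anti₀ hpos hle
  rwa [Real.exp_neg, inv_inv] at h

/-! ## §2 The defect Riccati bound (engine E12, PROVED) -/

/-- **THE DEFECT RICCATI BOUND** (engine E12).  Sobolev frame of D5; `0 < Λ₀`, `l₀ ≤ Λ₀`, `⟪∇u(t₀,x)e,e⟫ ≤ Λ₀`;
budget `Φ(t₀) = 0`, `0 ≤ Φ ≤ β`, `Φ' = b` on `[t₀,T)`; at every `δ`-almost strain maximiser above `l₀` on `[t₀,T)`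
the feed obeys `H ≤ c·q² + b(t)·q` with `1 ≤ c`.  THEN for every `t ∈ [t₀,T)` with `(c−1)·Λ₀e^{β}·(t − t₀) < 1`
and every `x`, unit `e`:  `⟪∇u(t,x)e,e⟫ ≤ Λ₀e^{β}·(1 − (c−1)Λ₀e^{β}(t − t₀))⁻¹`.  Proof: continuous a-priori
majorant `g = max(M_R, Λ₀)` (`M_R(s)` = sup of the strain form over `|x| ≤ R`, `|e| = 1`, `R` the decay radius of
`∇u` at level `Λ₀` on `[0,t]`), barrier `B = Λ₀e^{Φ}exp((c−1)∫g)` with `φ = b + (c−1)g` through E2_S♭-lin, growth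
from E1_S♭ + F_S + the hypothesis (`(c−1)q² ≤ (c−1)g·q`), then `g ≤ B ≤ Λ₀e^{β}exp((c−1)∫g)` and §1. [folklore] -/
theorem strain_le_of_defect {ν T t₀ l₀ δ β c Λ₀ : ℝ} {Φ b : ℝ → ℝ} (hν : 0 < ν) (ht₀ : 0 ≤ t₀) (ht₀T : t₀ < T)
    (hδ : 0 < δ) (hδ1 : δ < 1) (hc : 1 ≤ c) (hΛ₀ : 0 < Λ₀) (hlΛ : l₀ ≤ Λ₀) (hΦ0 : Φ t₀ = 0)
    (hΦ : ∀ t ∈ Ico t₀ T, 0 ≤ Φ t ∧ Φ t ≤ β ∧ HasDerivAt Φ (b t) t)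
    {u : ℝ → (EuclideanSpace ℝ (Fin 3)) → (EuclideanSpace ℝ (Fin 3))} {p : ℝ → (EuclideanSpace ℝ (Fin 3)) → ℝ}
    (hsol : IsClassicalNSSolutionOn (Ico 0 T) ν 0 u p) (hreg : ∀ T'' < T, HasBoundedSobolevNormsOn (Icc 0 T'') u)
    (hinit : ∀ (x e : EuclideanSpace ℝ (Fin 3)), ‖e‖ = 1 → strainQuad u t₀ x e ≤ Λ₀)
    (hhyp : ∀ t ∈ Ico t₀ T, ∀ (x e : EuclideanSpace ℝ (Fin 3)), IsStrainAlmostArgmax δ u t x e →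
      l₀ < strainQuad u t x e → strainFeed u p t x e ≤ c * strainQuad u t x e ^ 2 + b t * strainQuad u t x e) :
    ∀ t ∈ Ico t₀ T, (c - 1) * (Λ₀ * Real.exp β) * (t - t₀) < 1 →
      ∀ (x e : EuclideanSpace ℝ (Fin 3)), ‖e‖ = 1 →
        strainQuad u t x e ≤ Λ₀ * Real.exp β * (1 - (c - 1) * (Λ₀ * Real.exp β) * (t - t₀))⁻¹ := by
  intro t ht hsmall x e he
  have hT : 0 < T := lt_of_le_of_lt ht₀ ht₀T
  have hβ : 0 ≤ β := (hΦ t₀ ⟨le_rfl, ht₀T⟩).1.trans (hΦ t₀ ⟨le_rfl, ht₀T⟩).2.1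
  set A : ℝ := Λ₀ * Real.exp β with hA
  have hA0 : 0 < A := mul_pos hΛ₀ (Real.exp_pos β)
  have hΛA : Λ₀ ≤ A := by
    have : Λ₀ * 1 ≤ Λ₀ * Real.exp β := mul_le_mul_of_nonneg_left (Real.one_le_exp hβ) hΛ₀.le
    simpa [hA] using this
  set κ : ℝ := c - 1 with hκ
  have hκ0 : 0 ≤ κ := by rw [hκ]; linarith
  rcases eq_or_lt_of_le ht.1 with h0 | h0t
  · -- `t = t₀`
    subst h0
    have h1 : strainQuad u t₀ x e ≤ A := (hinit x e he).trans hΛA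
    have h2 : (1 - κ * A * (t₀ - t₀))⁻¹ = 1 := by simp
    rw [h2, mul_one]
    exact h1
  -- ### the main case `t₀ < t`: work on the closed slab `[t₀, t]`
  -- slab sup of `|u|` on `[0,t]`
  obtain ⟨K₀, -, hK₀⟩ : ∃ K₀ : ℝ, 0 ≤ K₀ ∧ ∀ s ∈ Icc 0 t, ∀ y : EuclideanSpace ℝ (Fin 3), ‖u s y‖ ≤ K₀ := by
    have hS : IsClassicalNSSolutionOn (Icc 0 t) ν 0 u p :=
      hsol.mono (Icc_subset_Ico_right ht.2) (uniqueDiffOn_Icc (lt_of_le_of_lt ht₀ h0t))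
    exact exists_forall_norm_le_of_hasBoundedSobolevNormsOn hS (hreg t ht.2)
  -- uniform spatial decay of `∇u` at level `Λ₀` on `[0,t]`
  obtain ⟨R, hR⟩ := gradientUniformDecay_holds ν T hν hT u p hsol hreg t ht.2 Λ₀ hΛ₀
  set R' : ℝ := max R 0 with hR'
  -- the compact set of (position, unit direction) and the clamped strain form
  set K : Set ((EuclideanSpace ℝ (Fin 3)) × (EuclideanSpace ℝ (Fin 3))) :=
    closedBall 0 R' ×ˢ sphere 0 1 with hKdef
  have hKc : IsCompact K := (isCompact_closedBall 0 R').prod (isCompact_sphere 0 1)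
  have hKne : K.Nonempty := by
    obtain ⟨e₁, he₁⟩ : ∃ e₁ : EuclideanSpace ℝ (Fin 3), ‖e₁‖ = 1 := ⟨e, he⟩
    exact ⟨(0, e₁), mem_closedBall_self (le_max_right _ _), by simpa using he₁⟩
  set cl : ℝ → ℝ := fun s => max t₀ (min s t) with hcl
  have hclc : Continuous cl := continuous_const.max (continuous_id.min continuous_const)
  have hclI : ∀ s, cl s ∈ Icc t₀ t := fun s =>
    ⟨le_max_left _ _, max_le h0t.le (min_le_right _ _)⟩
  have hclI' : ∀ s, cl s ∈ Ico 0 T := fun s => ⟨ht₀.trans (hclI s).1, lt_of_le_of_lt (hclI s).2 ht.2⟩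
  have hcl_id : ∀ s ∈ Icc t₀ t, cl s = s := fun s hs => by
    simp only [hcl, min_eq_left hs.2, max_eq_right hs.1]
  set f : ℝ → (EuclideanSpace ℝ (Fin 3)) × (EuclideanSpace ℝ (Fin 3)) → ℝ :=
    fun s z => strainQuad u (cl s) z.1 z.2 with hfdef
  have hco := hsol.smooth_velocity.continuousOn_fderiv_slice (uniqueDiffOn_Ico 0 T)
  have hf3 : Continuous fun q : ℝ × ((EuclideanSpace ℝ (Fin 3)) × (EuclideanSpace ℝ (Fin 3))) =>
      ⟪fderiv ℝ (u (cl q.1)) q.2.1 q.2.2, q.2.2⟫ := by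
    have h1 : Continuous fun q : ℝ × ((EuclideanSpace ℝ (Fin 3)) × (EuclideanSpace ℝ (Fin 3))) =>
        fderiv ℝ (u (cl q.1)) q.2.1 := by
      have h := hco.comp_continuous (f := fun q : ℝ × ((EuclideanSpace ℝ (Fin 3)) × (EuclideanSpace ℝ (Fin 3))) =>
        (cl q.1, q.2.1)) ((hclc.comp continuous_fst).prodMk (continuous_fst.comp continuous_snd))
        (fun q => ⟨hclI' q.1, mem_univ _⟩)
      exact h
    exact (h1.clm_apply (continuous_snd.comp continuous_snd)).inner (continuous_snd.comp continuous_snd)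
  have hf : Continuous (↿f) := hf3
  have hfs : ∀ s, Continuous (f s) := fun s => hf.comp (continuous_const.prodMk continuous_id)
  -- the continuous partial supremum and the majorant
  set MR : ℝ → ℝ := fun s => sSup (f s '' K) with hMR
  have hMRc : Continuous MR := hKc.continuous_sSup hf
  have hle_MR : ∀ s, ∀ z ∈ K, f s z ≤ MR s := fun s z hz =>
    le_csSup ((hKc.image (hfs s)).bddAbove) (mem_image_of_mem _ hz)
  have hMR_le : ∀ s M, (∀ z ∈ K, f s z ≤ M) → MR s ≤ M := fun s M h =>
    csSup_le (hKne.image _) (forall_mem_image.2 h)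
  set g : ℝ → ℝ := fun s => max (MR s) Λ₀ with hg
  have hgc : Continuous g := hMRc.max continuous_const
  have hgΛ : ∀ s, Λ₀ ≤ g s := fun s => le_max_right _ _
  have hgpos : ∀ s, 0 < g s := fun s => hΛ₀.trans_le (hgΛ s)
  -- `g` majorises the strain form on the slab
  have hqg : ∀ s ∈ Icc t₀ t, ∀ (y e' : EuclideanSpace ℝ (Fin 3)), ‖e'‖ = 1 → strainQuad u s y e' ≤ g s := by
    intro s hs y e' he'
    by_cases hy : R' ≤ ‖y‖
    · have h1 : strainQuad u s y e' ≤ Λ₀ :=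
        (strainQuad_le_opNorm u s y he').trans (hR s ⟨ht₀.trans hs.1, hs.2⟩ y ((le_max_left _ _).trans hy))
      exact h1.trans (hgΛ s)
    · push Not at hy
      have hz : (y, e') ∈ K := ⟨mem_closedBall.2 (by simpa using hy.le), by simpa using he'⟩
      have h1 : f s (y, e') ≤ MR s := hle_MR s _ hz
      have h2 : f s (y, e') = strainQuad u s y e' := by simp only [hfdef, hcl_id s hs]
      rw [h2] at h1
      exact h1.trans (le_max_left _ _)
  -- the primitive of `g` and the barrier
  set G : ℝ → ℝ := fun s => ∫ r in t₀..s, g r with hGdef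
  have hGd : ∀ s, HasDerivAt G (g s) s := fun s => (hgc.integral_hasStrictDerivAt t₀ s).hasDerivAt
  have hG0 : G t₀ = 0 := by simp [hGdef, intervalIntegral.integral_same]
  have hGnn : ∀ s, t₀ ≤ s → 0 ≤ G s := fun s hs =>
    intervalIntegral.integral_nonneg hs fun r _ => (hgpos r).le
  set B : ℝ → ℝ := fun s => Λ₀ * (Real.exp (Φ s) * Real.exp (κ * G s)) with hB
  set B' : ℝ → ℝ := fun s =>
    Λ₀ * (Real.exp (Φ s) * b s * Real.exp (κ * G s) + Real.exp (Φ s) * (Real.exp (κ * G s) * (κ * g s))) with hB'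
  set φ : ℝ → ℝ := fun s => b s + κ * g s with hφ
  have hBpos : ∀ s, 0 < B s := fun s => mul_pos hΛ₀ (mul_pos (Real.exp_pos _) (Real.exp_pos _))
  have hsub : ∀ s ∈ Icc t₀ t, s ∈ Ico t₀ T := fun s hs => ⟨hs.1, lt_of_le_of_lt hs.2 ht.2⟩
  have hBdA : ∀ s ∈ Icc t₀ t, HasDerivAt B (B' s) s := fun s hs =>
    (((hΦ s (hsub s hs)).2.2.exp).mul (((hGd s).const_mul κ).exp)).const_mul Λ₀
  have hBc : ContinuousOn B (Icc t₀ t) := fun s hs => (hBdA s hs).continuousAt.continuousWithinAt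
  have hBd : ∀ s ∈ Icc t₀ t, HasDerivWithinAt B (B' s) (Icc t₀ t) s := fun s hs => (hBdA s hs).hasDerivWithinAt
  have hsuper : ∀ s ∈ Icc t₀ t, φ s * B s ≤ B' s := fun s _ => le_of_eq (by simp only [hφ, hB, hB']; ring)
  have hBge : ∀ s ∈ Icc t₀ t, Λ₀ ≤ B s := fun s hs => by
    have h1 : 1 ≤ Real.exp (Φ s) := Real.one_le_exp (hΦ s (hsub s hs)).1
    have h2 : 1 ≤ Real.exp (κ * G s) := Real.one_le_exp (mul_nonneg hκ0 (hGnn s hs.1))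
    have h3 : 1 ≤ Real.exp (Φ s) * Real.exp (κ * G s) := one_le_mul_of_one_le_of_one_le h1 h2
    have : Λ₀ * 1 ≤ Λ₀ * (Real.exp (Φ s) * Real.exp (κ * G s)) := mul_le_mul_of_nonneg_left h3 hΛ₀.le
    simpa [hB] using this
  have hBle : ∀ s ∈ Icc t₀ t, B s ≤ A * Real.exp (κ * G s) := fun s hs => by
    have h1 : Real.exp (Φ s) ≤ Real.exp β := Real.exp_le_exp.2 (hΦ s (hsub s hs)).2.1
    have h2 : Real.exp (Φ s) * Real.exp (κ * G s) ≤ Real.exp β * Real.exp (κ * G s) :=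
      mul_le_mul_of_nonneg_right h1 (Real.exp_pos _).le
    have := mul_le_mul_of_nonneg_left h2 hΛ₀.le
    simpa [hB, hA, mul_assoc] using this
  -- ### growth at the charged crossing points: `∂ₜq ≤ (φ + η(ε))q`
  have hrate : ∀ ε : ℝ, 0 < ε → ε ≤ 1 → ∀ s ∈ Ioc t₀ t, ∀ (x e : EuclideanSpace ℝ (Fin 3)), ‖e‖ = 1 →
      (∀ (y e' : EuclideanSpace ℝ (Fin 3)), ‖e'‖ = 1 →
        (1 + ε * ‖y‖ ^ 2)⁻¹ * strainQuad u s y e' ≤ (1 + ε * ‖x‖ ^ 2)⁻¹ * strainQuad u s x e) →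
      (∀ (y e' : EuclideanSpace ℝ (Fin 3)), ‖e'‖ = 1 → (1 - δ) * strainQuad u s y e' ≤ strainQuad u s x e) →
      B s < strainQuad u s x e →
      strainRate T u s x e ≤ (φ s + (6 * ν * ε + Real.sqrt ε * K₀)) * strainQuad u s x e := by
    intro ε hε _ s hs x e he hpen halm hbig
    have hsI : s ∈ Ico 0 T := ⟨ht₀.trans hs.1.le, lt_of_le_of_lt hs.2 ht.2⟩
    have hsI' : s ∈ Ico t₀ T := ⟨hs.1.le, hsI.2⟩
    have hsc : s ∈ Icc t₀ t := ⟨hs.1.le, hs.2⟩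
    have hbig' : Λ₀ < strainQuad u s x e := lt_of_le_of_lt (hBge s hsc) hbig
    have hq0 : 0 < strainQuad u s x e := hΛ₀.trans hbig'
    have hsm : ContDiff ℝ ∞ (u s) := hsol.smooth_velocity.contDiff_slice hsI
    have heq := strainFrame_holds ν T hν hT u p hsol s hsI x e
    have hE := strainGrowthWeighted ν ε hν.le hε (u s) (p s) hsm x e he (fun y => hpen y e he) hq0.le _ heq
    have hfeed := hhyp s hsI' x e ⟨he, halm⟩ (lt_of_le_of_lt hlΛ hbig')
    have hux : ‖u s x‖ ≤ K₀ := hK₀ s ⟨hsI.1, hs.2⟩ x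
    have h1 : strainRate T u s x e ≤ -(strainQuad u s x e) ^ 2 + strainFeed u p s x e +
        (6 * ν * ε + Real.sqrt ε * ‖u s x‖) * strainQuad u s x e := by
      unfold strainRate strainQuad strainFeed pressureHess
      linarith [hE]
    have hallow : (6 * ν * ε + Real.sqrt ε * ‖u s x‖) * strainQuad u s x e ≤
        (6 * ν * ε + Real.sqrt ε * K₀) * strainQuad u s x e := by
      apply mul_le_mul_of_nonneg_right _ hq0.le
      have := mul_le_mul_of_nonneg_left hux (Real.sqrt_nonneg ε)
      linarith
    have hqg' : strainQuad u s x e ≤ g s := hqg s hsc x e he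
    have h2 : κ * strainQuad u s x e * strainQuad u s x e ≤ κ * strainQuad u s x e * g s :=
      mul_le_mul_of_nonneg_left hqg' (mul_nonneg hκ0 hq0.le)
    have h3 : c * strainQuad u s x e ^ 2 - strainQuad u s x e ^ 2 =
        κ * strainQuad u s x e * strainQuad u s x e := by rw [hκ]; ring
    have h4 : (φ s + (6 * ν * ε + Real.sqrt ε * K₀)) * strainQuad u s x e =
        b s * strainQuad u s x e + κ * strainQuad u s x e * g s +
          (6 * ν * ε + Real.sqrt ε * K₀) * strainQuad u s x e := by simp only [hφ]; ring
    rw [h4]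
    linarith [h1, hallow, hfeed, h2, h3]
  -- ### the device on `[t₀, t]`
  have hinit' : ∀ (y e' : EuclideanSpace ℝ (Fin 3)), ‖e'‖ = 1 → strainQuad u t₀ y e' ≤ B t₀ := by
    intro y e' he'
    have h0 : B t₀ = Λ₀ := by simp only [hB, hΦ0, hG0, mul_zero, Real.exp_zero, mul_one]
    rw [h0]
    exact hinit y e' he'
  have hdev := strainThresholdAlmostLinear_holds ν T t₀ t δ (fun ε => 6 * ν * ε + Real.sqrt ε * K₀) hν ht₀
    h0t ht.2 hδ hδ1 (tendsto_allowance ν K₀) u p hsol hreg B B' φ hBc (fun s _ => hBpos s) hBd hsuper hrate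
    hinit'
  -- ### the bootstrap `g ≤ A·exp(κ∫g)` on `[t₀,t]` and §1
  have hboot : ∀ s ∈ Icc t₀ t, g s ≤ A * Real.exp (κ * G s) := by
    intro s hs
    have hM : MR s ≤ B s := by
      refine hMR_le s (B s) fun z hz => ?_
      have hz2 : ‖z.2‖ = 1 := by
        have := hz.2
        simpa using this
      have h2 : f s z = strainQuad u s z.1 z.2 := by simp only [hfdef, hcl_id s hs]
      rw [h2]
      exact hdev s hs z.1 z.2 hz2
    exact (max_le hM (hBge s hs)).trans (hBle s hs)
  have hsmall' : κ * A * (t - t₀) < 1 := by simpa [hκ, hA] using hsmall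
  have hexp := exp_mul_integral_le_of_bootstrap hgc hA0 hκ0 hsmall' hboot t ⟨h0t.le, le_rfl⟩
  have hq : strainQuad u t x e ≤ B t := hdev t ⟨h0t.le, le_rfl⟩ x e he
  calc strainQuad u t x e ≤ B t := hq
    _ ≤ A * Real.exp (κ * G t) := hBle t ⟨h0t.le, le_rfl⟩
    _ ≤ A * (1 - κ * A * (t - t₀))⁻¹ := mul_le_mul_of_nonneg_left hexp hA0.le

end Summit.NavierStokesRegularity.NavierStokesRegularity.Theorems.StrainDoors

end
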